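import Summits.Ventures.CertifiedArithmetic.LowPrec.DoubleRoundingProductSameQuantumTable
import Summits.Ventures.CertifiedArithmetic.LowPrec.DoubleRoundingProductSameQuantumLow
import Summits.Ventures.CertifiedArithmetic.LowPrec.DoubleRoundingProductSameQuantumWindow

/-!
# Double rounding of products through a same-quantum register: the decision (innocuous iff P ≤ 3)

HONEST FRAMING (venture CertifiedArithmetic / cell `pub-lowprec`): certified error envelopes and
provably optimal rounding/accumulation schemes for low-precision formats under stated cost models;
every table by two implementations; no hardware or vendor claims.

`DoubleRoundingProductSameQuantum.lean` proved THEOREM N-mul-0 — at equal quanta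
(`L_ψ = L_φ`, `d = 0`) some product of `φ`-data slips through every more precise register as
soon as `P_φ ≥ 4` — and decided the positive side `P_φ ≤ 3` only on pseudo-record cells (kernel
exhaustion of `≤ 64`-value sources).  This file proves the positive side FOR EVERY PAIR OF
RECORDS and so DECIDES `DRMul φ ψ` (`fl_φ (fl_ψ (a·b)) = fl_φ (a·b)` for all data `a, b` of `φ`)
at `d = 0` for registers at least twice as precise:

  for `F_φ ⊆ F_ψ` (`embedsTest`), `L_ψ = L_φ`, `m = m_φ ≥ 1`, `m_ψ ≥ 2m + 1` (`P_ψ ≥ 2P_φ`),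
  `2^(2m+1) ≤ M_φ` (the products reach the binades where `φ` is coarser than the register) and
  `2^(bias+m-1) ≤ M_φ` (`1 ≤ maxRat φ`):      `DRMul φ ψ ↔ m ≤ 2`      (`drMul_sameQ_iff`).

Mechanism — ONE GRID INSIDE ANOTHER (`q` = the common quantum; below `2^(m_ψ+1)·q` the register
holds EVERY multiple of `q`).  A product of `φ`-data is `K·2^E·q`, `K = oa·ob` the product of the
odd parts (`K < 2^(2P) ≤ 2^(P_ψ)`): saturated, zero, exact in `ψ` (`E ≥ 0`), or `x = K·q/2^u` with
`u ≥ 1`; then either `K < 2^(m+1+u)` — the fine zone, no slip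
(`DoubleRoundingProductSameQuantumLow.lean`) — or `2^(m+w+u) ≤ K < 2^(m+w+u+1)` with `1 ≤ w`,
`w + u ≤ m + 1`, the cell index `c = K / 2^(w+u)` a normal significand, `(c+1)·2^w ≤ 2^(2m+1) ≤
M_φ ≤ M_ψ`, and a slip is a hit of the window (`DoubleRoundingProductSameQuantumWindow.lean`,
`DoubleRoundingProductSameQuantumTable.lean`), which has NO hit for `P ≤ 3` and one for every
`P ≥ 4`.  The negative side is N-mul-0 (`not_drMul_of_qexp_eq`); the two range hypotheses make its
split `α + β = bias` exist for every record (`not_drMul_sameQ_of_three_le`).  `2^(bias+m-1) ≤ M_φ`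
cannot be dropped: the record `⟨3, 20, 5, 7⟩` (`m = 3`, `M = 240 ≥ 2^7`, `maxRat = 240·2^-22`) has
every product of its data below `q/2`, so both roundings return `0` and `DRMul` holds at `m = 3`
(implementation A, Part 4, by brute force); `2^(2m+1) ≤ M_φ` puts every cell met by an inexact
product inside the range of `φ` and is a convenience of the proof (all `40` rows of implementation
A's grid violating only it still follow the verdict `m ≤ 2`).

* §1 `drMul_of_mulSameQHit_eq_false` (no hit, no slip — every record), N-mul-0 under the range
  hypotheses, THE DECISION `drMul_sameQ_iff` / `drMul_sameQ_iff_hit`, and its boolean-hypothesis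
  form `mulSameQLawHyp` / `drMul_sameQ_iff_of_hyp`.
* §2 instances: the cells of `DoubleRoundingProductSameQuantum.lean` §3 re-derived WITHOUT
  exhaustion, registers the kernel never enumerated (`P_ψ = 2P+1, 3P` for `P = 2, 3`; `P = 5`
  with `P_ψ = 10`), and the named `13 × 13` matrix (the hypothesis never holds: no named
  same-quantum pair has `P_ψ ≥ 2P_φ` — a register-design statement, as N-mul-0).

So at `d = 0` the verdict is a threshold in the SOURCE precision alone (`P_φ ≤ 3`), for every
register precision `P_ψ ≥ 2P_φ` and every range; the strip `P_φ < P_ψ < 2P_φ` at `d = 0` (products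
inexact in `ψ` at `E ≥ 0`) stays with implementation A and the cells `sameQ_strip_cells`.
Two implementations: A = `code/enum/mul_sameq_decision.py` (exact rationals: `DRMul` brute force
on pseudo-records at `d = 0` against `m ≤ 2` on every row satisfying `mulSameQLawHyp`, the
hypothesis evaluated on the named matrix and on the records of §2) →
`certs/enum/DOUBLE-ROUNDING-MUL-SAMEQ-LAW.json`; B = this file (structural, every record; `decide`
on the records of §2).
PLACEMENT — KNOWN: innocuous double rounding of products for `p₂ ≥ 2p₁` when the first rounding
sees no underflow ([Figueroa1995] §3; [Roux2014] Table II, `emin₂ ≤ 2 emin₁` in the FLT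
convention — the opposite extreme of `emin₂ = emin₁`); slips only through midpoints
([MartinDorelMelquiondMuller2013] Property 2.1; [BoldoMelquiond2008] Thm 3); gradual underflow
as a source of double-rounding slips in general terms ([MullerEtAl2018] §3.3.1, §7.6).  We found
no statement in print deciding the same-quantum (equal-`emin`) register by the source precision
(`p₁ ≤ 3` innocuous for all `p₂ ≥ 2p₁`, `p₁ ≥ 4` never); searches logged in
`pub-lowprec-enum/FRESHNESS-ENUM.md` (gen23, gen24) and `DOUBLE-ROUNDING-MUL.md` §10–11.
NEW (modestly): the record-generic decision at `d = 0`.  No hardware or vendor claims.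
-/

namespace Summit.Ventures.CertifiedArithmetic

open Literature.ComputerArithmetic.FloatingPoint
open Literature.ComputerArithmetic.FloatingPoint.Format
open Literature.ComputerArithmetic.FloatingPoint.MiniFloat

/-! ## §1 The converse on records, N-mul-0 under the range hypotheses, the decision -/

/-- NO HIT, NO SLIP (the converse at `d = 0`) — for EVERY pair of format records with
`F_φ ⊆ F_ψ` (`embedsTest`), `L_ψ = L_φ`, `m = m_φ ≥ 1`, `m_ψ ≥ 2m + 1` (`P_ψ ≥ 2P_φ`) and
`2^(2m+1) ≤ M_φ`: `mulSameQHit (m+1) = false ⟹ DRMul φ ψ`.  A product is saturated, or zero, or a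
value of `ψ` (odd parts `K = oa·ob < 2^(2P) ≤ 2^(P_ψ)` at a nonnegative exponent, below
`maxRat φ ≤ maxRat ψ`), or `K·q/2^u` with `u ≥ 1`: in the low zone (`K < 2^(m+1+u)`)
`sameQ_roundNE_roundNE_low` shows no slip; else `2^(m+w+u) ≤ K < 2^(m+w+u+1)` with `1 ≤ w`,
`w + u ≤ m + 1` (`K < 2^(2m+2)`), the cell index `c = K / 2^(w+u)` is a normal significand,
`(c+1)·2^w ≤ 2^(2m+1) ≤ M_φ ≤ M_ψ`, and `sameQ_window_of_roundNE_roundNE_ne` turns a slip into a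
hit. [this packet] -/
theorem drMul_of_mulSameQHit_eq_false {φ ψ : Format} (hE : embedsTest φ ψ = true)
    (hq : ψ.qexp = φ.qexp) (h1 : 1 ≤ φ.manBits) (hm : 2 * φ.manBits + 1 ≤ ψ.manBits)
    (hR : 2 ^ (2 * φ.manBits + 1) ≤ φ.maxScaled)
    (hhit : mulSameQHit (φ.manBits + 1) = false) : DRMul φ ψ := by
  have htop := exists_toRat_eq_maxRat_of_test hE
  simp only [embedsTest, Bool.and_eq_true, decide_eq_true_eq] at hE
  obtain ⟨⟨-, hq'⟩, hMM⟩ := hE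
  have hmax := (maxRat_le_maxRat_iff hq').2 hMM
  rw [show (φ.qexp - ψ.qexp).toNat = 0 by omega, pow_zero, mul_one] at hMM
  have hQ : ψ.quantum = φ.quantum := by
    show (2 : ℚ) ^ ψ.qexp = (2 : ℚ) ^ φ.qexp
    rw [hq]
  have h2m2 : 2 ^ (2 * φ.manBits + 2) ≤ 2 ^ (ψ.manBits + 1) :=
    Nat.pow_le_pow_right (by norm_num) (by omega)
  have h2m1 : 2 ^ (2 * φ.manBits + 1) < 2 ^ (2 * φ.manBits + 2) :=
    Nat.pow_lt_pow_right (by norm_num) (by omega)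
  have hm1 : 2 ^ (φ.manBits + 1) ≤ 2 ^ (2 * φ.manBits + 1) :=
    Nat.pow_le_pow_right (by norm_num) (by omega)
  intro a b
  rcases le_or_gt φ.maxRat |a.toRat * b.toRat| with hsat | hlt
  · exact toRat_roundNE_roundNE_of_maxRat_le_abs htop hsat
  have habs := abs_toRat_mul_toRat a b
  by_cases h0 : a.scaledMag * b.scaledMag = 0
  · have hx0 : a.toRat * b.toRat = 0 := abs_eq_zero.mp (by rw [habs, h0]; simp)
    rw [hx0]; exact toRat_roundNE_roundNE_of_exists ⟨zero ψ, toRat_zero⟩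
  obtain ⟨ha0, hb0⟩ := mul_ne_zero_iff.mp h0
  obtain ⟨oa, ja, hoa, hoa', hsa⟩ := exists_odd_mul_two_pow a ha0
  obtain ⟨ob, jb, hob, hob', hsb⟩ := exists_odd_mul_two_pow b hb0
  have hK2 : oa * ob < 2 ^ (2 * φ.manBits + 2) := by
    calc oa * ob < 2 ^ (φ.manBits + 1) * 2 ^ (φ.manBits + 1) :=
          Nat.mul_lt_mul_of_lt_of_le hoa' hob'.le (by positivity)
      _ = 2 ^ (2 * φ.manBits + 2) := by rw [← pow_add]; congr 1; omega
  have hKψ : oa * ob < 2 ^ (ψ.manBits + 1) := lt_of_lt_of_le hK2 h2m2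
  have hK0 : oa * ob ≠ 0 := by
    intro h; rcases mul_eq_zero.mp h with h' | h' <;> omega
  -- `|a·b| = K · 2^E · q`, `K = oa·ob`, `E = ja + jb + L_φ`
  obtain ⟨E, hE_def⟩ : ∃ E : ℤ, ((ja + jb : ℕ) : ℤ) + 2 * φ.qexp - ψ.qexp = E := ⟨_, rfl⟩
  have h2E : (2 : ℚ) ^ E * 2 ^ ψ.qexp = (2 : ℚ) ^ (ja + jb) * 2 ^ (φ.qexp + φ.qexp) := by
    rw [← zpow_natCast, ← zpow_add₀ two_ne_zero, ← zpow_add₀ two_ne_zero]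
    congr 1; push_cast; omega
  have habs' : |a.toRat * b.toRat| = ((oa * ob : ℕ) : ℚ) * (2 : ℚ) ^ E * ψ.quantum := by
    rw [habs, hsa, hsb]; unfold Format.quantum
    rw [mul_assoc (((oa * ob : ℕ)) : ℚ), h2E]; push_cast; ring
  rcases le_or_gt 0 E with hE0 | hE0
  · -- exact in `ψ`
    have hxE : |a.toRat * b.toRat| = ((oa * ob * 2 ^ E.toNat : ℕ) : ℚ) * ψ.quantum := by
      rw [habs']; push_cast; rw [← zpow_natCast, Int.toNat_of_nonneg hE0]
    refine toRat_roundNE_roundNE_of_exists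
      (exists_toRat_eq_of_abs_eq_natMul (representable_mul_pow hKψ ?_) hxE)
    have h' : ((oa * ob * 2 ^ E.toNat : ℕ) : ℚ) * ψ.quantum < (ψ.maxScaled : ℚ) * ψ.quantum := by
      rw [← hxE]; exact lt_of_lt_of_le hlt hmax
    exact_mod_cast (lt_of_mul_lt_mul_right h' ψ.quantum_pos.le).le
  -- `u ≥ 1`
  obtain ⟨u, hu'⟩ : ∃ u : ℕ, (-E).toNat = u := ⟨_, rfl⟩
  obtain ⟨hu, hEu⟩ : 1 ≤ u ∧ E = -(u : ℤ) := ⟨by omega, by omega⟩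
  have hxu : |a.toRat * b.toRat| = ((oa * ob : ℕ) : ℚ) * φ.quantum / 2 ^ u := by
    rw [habs', hEu, zpow_neg, zpow_natCast, hQ]; ring
  by_contra hne
  have hne' : (roundNE φ (roundNE ψ |a.toRat * b.toRat|).toRat).toRat
      ≠ (roundNE φ |a.toRat * b.toRat|).toRat :=
    fun h => hne (toRat_roundNE_roundNE_of_abs h)
  rw [hxu] at hne'
  rcases Nat.lt_or_ge (oa * ob) (2 ^ (φ.manBits + 1 + u)) with hlow | hhigh
  · -- the low zone
    obtain ⟨c, hc'⟩ : ∃ c, oa * ob / 2 ^ u = c := ⟨_, rfl⟩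
    obtain ⟨r, hr'⟩ : ∃ r, oa * ob % 2 ^ u = r := ⟨_, rfl⟩
    obtain ⟨hKcr, hrK⟩ := (Nat.div_mod_unique (a := oa * ob) (b := 2 ^ u) (c := r) (d := c)
      (by positivity)).mp ⟨hc', hr'⟩
    have hKcr' : oa * ob = c * 2 ^ u + r := by rw [← hKcr]; ring
    have hc1 : c + 1 ≤ 2 ^ (φ.manBits + 1) := by
      have : c < 2 ^ (φ.manBits + 1) := by
        rw [← hc', Nat.div_lt_iff_lt_mul (by positivity), ← pow_add]; exact hlow
      omega
    rw [hKcr'] at hne'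
    exact hne' (sameQ_roundNE_roundNE_low hq h1 (by omega) hu hrK hc1 (by omega)
      (by omega) (by omega))
  · -- a binade of spacing `2^w q`, `1 ≤ w`, `w + u ≤ m + 1`
    obtain ⟨G, hG'⟩ : ∃ G, Nat.log 2 (oa * ob) = G := ⟨_, rfl⟩
    have hGle : 2 ^ G ≤ oa * ob := hG' ▸ Nat.pow_log_le_self 2 hK0
    have hGlt : oa * ob < 2 ^ (G + 1) := hG' ▸ Nat.lt_pow_succ_log_self (by norm_num) _
    have hG1 : φ.manBits + 1 + u ≤ G := by
      by_contra h
      have := Nat.pow_le_pow_right (n := 2) (by norm_num) (show G + 1 ≤ φ.manBits + 1 + u by omega)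
      omega
    have hG2 : G ≤ 2 * φ.manBits + 1 := by
      by_contra h
      have := Nat.pow_le_pow_right (n := 2) (by norm_num) (show 2 * φ.manBits + 2 ≤ G by omega)
      omega
    obtain ⟨w, hw'⟩ : ∃ w, G - φ.manBits - u = w := ⟨_, rfl⟩
    have hw : 1 ≤ w := by omega
    have hGw : G = φ.manBits + (w + u) := by omega
    obtain ⟨c, hc'⟩ : ∃ c, oa * ob / 2 ^ (w + u) = c := ⟨_, rfl⟩
    obtain ⟨r, hr'⟩ : ∃ r, oa * ob % 2 ^ (w + u) = r := ⟨_, rfl⟩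
    obtain ⟨hKcr, hrK⟩ := (Nat.div_mod_unique (a := oa * ob) (b := 2 ^ (w + u)) (c := r)
      (d := c) (by positivity)).mp ⟨hc', hr'⟩
    have hKcr' : oa * ob = c * 2 ^ (w + u) + r := by rw [← hKcr]; ring
    have hclo : 2 ^ φ.manBits ≤ c := by
      rw [← hc', Nat.le_div_iff_mul_le (by positivity), ← pow_add, ← hGw]; exact hGle
    have hchi : c < 2 ^ (φ.manBits + 1) := by
      rw [← hc', Nat.div_lt_iff_lt_mul (by positivity), ← pow_add,
        show φ.manBits + 1 + (w + u) = G + 1 by omega]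
      exact hGlt
    have hcw : (c + 1) * 2 ^ w ≤ 2 ^ (2 * φ.manBits + 1) := by
      calc (c + 1) * 2 ^ w ≤ 2 ^ (φ.manBits + 1) * 2 ^ w := Nat.mul_le_mul_right _ hchi
        _ = 2 ^ (φ.manBits + 1 + w) := (pow_add _ _ _).symm
        _ ≤ 2 ^ (2 * φ.manBits + 1) := Nat.pow_le_pow_right (by norm_num) (by omega)
    have hcM : (c + 1) * 2 ^ w ≤ φ.maxScaled := le_trans hcw hR
    have hψm : (c + 1) * 2 ^ w < 2 ^ (ψ.manBits + 1) :=
      lt_of_le_of_lt hcw (lt_of_lt_of_le h2m1 h2m2)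
    have hψM : (c + 1) * 2 ^ w ≤ ψ.maxScaled := le_trans hcM hMM
    rw [hKcr'] at hne'
    have hwin := sameQ_window_of_roundNE_roundNE_ne hq h1 (by omega) hu hw hrK hclo hchi hcM
      hψm hψM hne'
    have hAt : mulSameQHitAt (φ.manBits + 1) w u oa ob = true :=
      mulSameQHitAt_of_window (n := w + u - 1) rfl
        (by rw [show w + u - 1 + 1 = w + u by omega]; exact hKcr')
        (by rw [show w + u - 1 + 1 = w + u by omega]; exact hrK)
        (by rw [Nat.add_sub_cancel]; exact hclo) hchi hwin
    have := mulSameQHit_of_hitAt hw (by omega) hu (by omega) hoa (by simpa using hoa') hob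
      (by simpa using hob') hAt
    rw [hhit] at this
    exact Bool.false_ne_true this

/-- THEOREM N-mul-0 UNDER THE RANGE HYPOTHESES — for EVERY pair of records with `L_ψ = L_φ`,
`m = m_φ ≥ 3`, `m_ψ ≥ m + 1`, `M_φ ≤ M_ψ`, `2^(2m+1) ≤ M_φ` and `2^(bias+m-1) ≤ M_φ`
(`1 ≤ maxRat φ`): `¬ DRMul φ ψ`.  The two range hypotheses provide N-mul-0's split `α + β = bias`
with both witness data in range (`bias ≤ 2m+1`: `α = min(bias, m+1)`; else `α = bias - 1`,
`β = 1`) and its `2^(m+1) + 4 ≤ M_φ ≤ M_ψ`. [this packet] -/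
theorem not_drMul_sameQ_of_three_le {φ ψ : Format} (hq : ψ.qexp = φ.qexp)
    (h3 : 3 ≤ φ.manBits) (hP : φ.manBits + 1 ≤ ψ.manBits) (hMM : φ.maxScaled ≤ ψ.maxScaled)
    (hR : 2 ^ (2 * φ.manBits + 1) ≤ φ.maxScaled)
    (hone : 2 ^ (φ.bias + φ.manBits - 1) ≤ φ.maxScaled) : ¬ DRMul φ ψ := by
  have h8 : 8 ≤ 2 ^ φ.manBits := le_trans (by norm_num) (Nat.pow_le_pow_right (by norm_num) h3)
  have h2m : 2 ^ (2 * φ.manBits + 1) = 2 ^ φ.manBits * 2 ^ (φ.manBits + 1) := by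
    rw [← pow_add]; congr 1; omega
  have hX : 2 ^ (φ.manBits + 1) + 4 ≤ φ.maxScaled := by
    have : 8 * 2 ^ (φ.manBits + 1) ≤ 2 ^ (2 * φ.manBits + 1) := by
      rw [h2m]; exact Nat.mul_le_mul_right _ h8
    omega
  have hY : 2 ^ (φ.manBits + 1) + 3 ≤ ψ.maxScaled := by omega
  have hhalf : 2 ^ (φ.manBits - 1) + 1 ≤ 2 ^ φ.manBits := by
    have e : 2 ^ φ.manBits = 2 * 2 ^ (φ.manBits - 1) := by rw [← pow_succ']; congr 1; omega
    have : 1 ≤ 2 ^ (φ.manBits - 1) := Nat.one_le_two_pow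
    omega
  rcases le_or_gt φ.bias (2 * φ.manBits + 1) with hb | hb
  · obtain ⟨α, hα1, hα2, hα3⟩ : ∃ α, α ≤ φ.bias ∧ α ≤ φ.manBits + 1 ∧ φ.bias - α ≤ φ.manBits := by
      rcases le_or_gt φ.bias (φ.manBits + 1) with h | h
      · exact ⟨φ.bias, le_rfl, h, by omega⟩
      · exact ⟨φ.manBits + 1, h.le, le_rfl, by omega⟩
    refine not_drMul_of_qexp_eq hq h3 hP (α := α) (β := φ.bias - α) (by omega) ?_ ?_ hX hY
    · calc (2 ^ (φ.manBits - 1) + 1) * 2 ^ α ≤ 2 ^ φ.manBits * 2 ^ (φ.manBits + 1) :=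
            Nat.mul_le_mul hhalf (Nat.pow_le_pow_right (by norm_num) hα2)
        _ = 2 ^ (2 * φ.manBits + 1) := h2m.symm
        _ ≤ φ.maxScaled := hR
    · calc (2 ^ (φ.manBits + 1) - 1) * 2 ^ (φ.bias - α) ≤ 2 ^ (φ.manBits + 1) * 2 ^ φ.manBits :=
            Nat.mul_le_mul (Nat.sub_le _ _) (Nat.pow_le_pow_right (by norm_num) hα3)
        _ = 2 ^ (2 * φ.manBits + 1) := by rw [← pow_add]; congr 1; omega
        _ ≤ φ.maxScaled := hR
  · refine not_drMul_of_qexp_eq hq h3 hP (α := φ.bias - 1) (β := 1) (by omega) ?_ ?_ hX hY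
    · calc (2 ^ (φ.manBits - 1) + 1) * 2 ^ (φ.bias - 1) ≤ 2 ^ φ.manBits * 2 ^ (φ.bias - 1) :=
            Nat.mul_le_mul_right _ hhalf
        _ = 2 ^ (φ.bias + φ.manBits - 1) := by rw [← pow_add]; congr 1; omega
        _ ≤ φ.maxScaled := hone
    · rw [pow_one]
      calc (2 ^ (φ.manBits + 1) - 1) * 2 ≤ 2 ^ (φ.manBits + 1) * 2 ^ φ.manBits :=
            Nat.mul_le_mul (Nat.sub_le _ _) (by omega)
        _ = 2 ^ (2 * φ.manBits + 1) := by rw [← pow_add]; congr 1; omega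
        _ ≤ φ.maxScaled := hR

/-- THE POSITIVE SIDE, every record: `m_φ ≤ 2` (`P_φ ≤ 3`) `⟹ DRMul φ ψ` under the hypotheses of
`drMul_of_mulSameQHit_eq_false` (the table has no hit for `P ≤ 3`). [this packet] -/
theorem drMul_sameQ_of_manBits_le_two {φ ψ : Format} (hE : embedsTest φ ψ = true)
    (hq : ψ.qexp = φ.qexp) (h1 : 1 ≤ φ.manBits) (hm : 2 * φ.manBits + 1 ≤ ψ.manBits)
    (hR : 2 ^ (2 * φ.manBits + 1) ≤ φ.maxScaled) (h2 : φ.manBits ≤ 2) : DRMul φ ψ := by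
  have h4 : ∀ Q < 4, mulSameQHit Q = false := by decide +kernel
  exact drMul_of_mulSameQHit_eq_false hE hq h1 hm hR (h4 _ (by omega))

/-- THE DECISION AT EQUAL QUANTA — for EVERY pair of format records with `F_φ ⊆ F_ψ`
(`embedsTest`), `L_ψ = L_φ`, `m = m_φ ≥ 1`, `m_ψ ≥ 2m + 1` (`P_ψ ≥ 2P_φ`), `2^(2m+1) ≤ M_φ` and
`2^(bias+m-1) ≤ M_φ` (`1 ≤ maxRat φ`):      `DRMul φ ψ ↔ m ≤ 2`      — innocuous iff `P_φ ≤ 3`,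
whatever the register precision `≥ 2P_φ` and the ranges. [this packet] -/
theorem drMul_sameQ_iff {φ ψ : Format} (hE : embedsTest φ ψ = true) (hq : ψ.qexp = φ.qexp)
    (h1 : 1 ≤ φ.manBits) (hm : 2 * φ.manBits + 1 ≤ ψ.manBits)
    (hR : 2 ^ (2 * φ.manBits + 1) ≤ φ.maxScaled)
    (hone : 2 ^ (φ.bias + φ.manBits - 1) ≤ φ.maxScaled) : DRMul φ ψ ↔ φ.manBits ≤ 2 := by
  refine ⟨fun hD => ?_, drMul_sameQ_of_manBits_le_two hE hq h1 hm hR⟩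
  by_contra h2
  have hE' := hE
  simp only [embedsTest, Bool.and_eq_true, decide_eq_true_eq] at hE'
  obtain ⟨⟨-, hq'⟩, hMM⟩ := hE'
  rw [show (φ.qexp - ψ.qexp).toNat = 0 by omega, pow_zero, mul_one] at hMM
  exact not_drMul_sameQ_of_three_le hq (by omega) (by omega) hMM hR hone hD

/-- THE DECISION READ THROUGH THE TABLE: under the same hypotheses
`DRMul φ ψ ↔ mulSameQHit (m+1) = false`. [this packet] -/
theorem drMul_sameQ_iff_hit {φ ψ : Format} (hE : embedsTest φ ψ = true) (hq : ψ.qexp = φ.qexp)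
    (h1 : 1 ≤ φ.manBits) (hm : 2 * φ.manBits + 1 ≤ ψ.manBits)
    (hR : 2 ^ (2 * φ.manBits + 1) ≤ φ.maxScaled)
    (hone : 2 ^ (φ.bias + φ.manBits - 1) ≤ φ.maxScaled) :
    DRMul φ ψ ↔ mulSameQHit (φ.manBits + 1) = false := by
  rw [drMul_sameQ_iff hE hq h1 hm hR hone]
  have := (mulSameQHit_eq_true_iff (P := φ.manBits + 1)).not
  rw [Bool.not_eq_true] at this
  rw [this]; omega

/-- THE HYPOTHESIS OF THE DECISION AS A BOOLEAN TEST on records. [this packet] -/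
def mulSameQLawHyp (φ ψ : Format) : Bool :=
  embedsTest φ ψ && decide (ψ.qexp = φ.qexp) && decide (1 ≤ φ.manBits) &&
    decide (2 * φ.manBits + 1 ≤ ψ.manBits) && decide (2 ^ (2 * φ.manBits + 1) ≤ φ.maxScaled) &&
    decide (2 ^ (φ.bias + φ.manBits - 1) ≤ φ.maxScaled)

/-- THE DECISION UNDER THE BOOLEAN HYPOTHESIS: `mulSameQLawHyp φ ψ ⟹ (DRMul φ ψ ↔ m_φ ≤ 2)`.
[this packet] -/
theorem drMul_sameQ_iff_of_hyp {φ ψ : Format} (h : mulSameQLawHyp φ ψ = true) :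
    DRMul φ ψ ↔ φ.manBits ≤ 2 := by
  simp only [mulSameQLawHyp, Bool.and_eq_true, decide_eq_true_eq] at h
  obtain ⟨⟨⟨⟨⟨hE, hq⟩, h1⟩, hm⟩, hR⟩, hone⟩ := h
  exact drMul_sameQ_iff hE hq h1 hm hR hone

/-! ## §2 Instances: the cells without exhaustion, registers beyond the kernel, the named matrix -/

/-- THE CELLS OF `DoubleRoundingProductSameQuantum.lean` §3 BY THE DECISION (there: kernel
exhaustion of the `P = 2, 3` sources and N-mul-0's test; here: three record inequalities each):
`Z2 → Z2reg` (`P_ψ = 4`) and `Z3 → Z3reg` (`P_ψ = 6`) innocuous, `Z4 → Z4reg` (`P_ψ = 8`) not.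
(`Q8` has `maxRat < 1/4 < 1` and is outside the hypothesis; it stays with N-mul-0's test.)
[this packet] -/
theorem sameQ_cells_by_law : (DRMul Z2 Z2reg ∧ DRMul Z3 Z3reg) ∧ ¬ DRMul Z4 Z4reg :=
  ⟨⟨(drMul_sameQ_iff_of_hyp (by decide)).2 (by decide),
      (drMul_sameQ_iff_of_hyp (by decide)).2 (by decide)⟩,
    fun h => absurd ((drMul_sameQ_iff_of_hyp (by decide)).1 h) (by decide)⟩

/-- Same-quantum register of precision `5 = 2P + 1` for `Z2`: `L = -4`, `M = 31`. [this packet] -/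
def R2p5 : Format := ⟨4, 1, 1, 15, by decide⟩
/-- Same-quantum register of precision `6 = 3P` for `Z2`: `L = -4`, `M = 63`. [this packet] -/
def R2p6 : Format := ⟨5, 0, 1, 31, by decide⟩
/-- `P = 3` source with a longer exponent range: `m = 2`, `bias = 8`, `L = -9`, `M = 896`.
[this packet] -/
def Z3b : Format := ⟨2, 8, 8, 3, by decide⟩
/-- Same-quantum register of precision `7 = 2P + 1` for `Z3b`: `L = -9`, `M = 1016`.
[this packet] -/
def R3p7 : Format := ⟨6, 4, 4, 63, by decide⟩
/-- Same-quantum register of precision `9 = 3P` for `Z3b`: `L = -9`, `M = 1022`. [this packet] -/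
def R3p9 : Format := ⟨8, 2, 2, 255, by decide⟩
/-- `P = 5` source: `m = 4`, `bias = 8`, `L = -11`, `M = 3968`. [this packet] -/
def Z5 : Format := ⟨4, 8, 8, 15, by decide⟩
/-- Same-quantum register of precision `10 = 2P` for `Z5`: `L = -11`, `M = 4092`. [this packet] -/
def R5p10 : Format := ⟨9, 3, 3, 511, by decide⟩

/-- CELLS THE KERNEL NEVER ENUMERATED, by the decision: the `P = 2` products are innocuous through
the same-quantum registers of precision `5` and `6`, the `P = 3` products (`Z3b`, `81`-value
source) through those of precision `7` and `9`, and the `P = 5` products slip through the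
same-quantum register of precision `10` — the verdict depends on `P_φ` alone. [this packet] -/
theorem sameQ_law_cells : (DRMul Z2 R2p5 ∧ DRMul Z2 R2p6 ∧ DRMul Z3b R3p7 ∧ DRMul Z3b R3p9) ∧
    ¬ DRMul Z5 R5p10 :=
  ⟨⟨(drMul_sameQ_iff_of_hyp (by decide)).2 (by decide),
      (drMul_sameQ_iff_of_hyp (by decide)).2 (by decide),
      (drMul_sameQ_iff_of_hyp (by decide)).2 (by decide),
      (drMul_sameQ_iff_of_hyp (by decide)).2 (by decide)⟩,
    fun h => absurd ((drMul_sameQ_iff_of_hyp (by decide)).1 h) (by decide)⟩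

/-- THE NAMED `13 × 13` MATRIX: the hypothesis of the decision holds on NO named pair (equal quanta
occur only for binary8p3 / binary8p3f and binary8p4 / binary8p4f, of equal precision) — as for
N-mul-0, the same-quantum register twice as precise is a design point, not a named pair.
[this packet] -/
theorem mulSameQLaw_named : ∀ X ∈ namedFormats, ∀ Y ∈ namedFormats,
    mulSameQLawHyp X Y = false := by
  decide

end Summit.Ventures.CertifiedArithmetic
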